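import Literature.Barriers.MatrixMultiplication.UnstableTensorBarrierTorus
import Literature.Barriers.MatrixMultiplication.UnstableTensorBarrierSliceRankBound
import Literature.Barriers.MatrixMultiplication.UnstableTensorBarrierWeightBound
import Literature.Computability.AlgebraicComplexity.AsymptoticSpectrumDuality
import Literature.Computability.AlgebraicComplexity.AsymptoticSubrankDuality
import HarnessLib

/-!
# Proof of Bläser–Lysikov 2020, Theorem 17 (`BlaserLysikov2020_thm17_holds`)

Topic `Literature/Barriers/MatrixMultiplication`; DISCHARGE of the named fact
`BlaserLysikov2020_thm17` of `UnstableTensorBarrier.lean`: for an unstable concise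
`t ∈ ℂ^{n×n×n}`, `n ≥ 2`, `(1 - 3^{-3n}/(18 n⁴ ln n))⁻¹ · log Q̃(t) ≤ log R̃(t)`.
Everything here is PROVED.

## Proof (assembled from the three preceding files)

* `IsUnstable.exists_sepWeight` (`…Torus.lean`): a unitary change of bases `s` of `t` carries real
  weights of total sum `0` on each index set with `x a + y b + z c ≥ 1` on `supp s`;
* `exists_bounded_sepWeight` (`…WeightBound.lean`): such weights exist with entries
  `≤ c = 2n√3^{3n}`;
* `asymptoticSubrank_le_of_sepWeight` (`…SliceRankBound.lean`): `Q̃(t) ≤ n·e^{-1/(2(3c)²)}`;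
* `R̃(t) ≥ ζ⁽¹⁾(t) = n` for concise `t` (gauge points are spectral points below `R̃`, both in the
  tree: `gaugePoint₁_isUniversalSpectralPoint`, `strassen_duality_asymptoticRank_holds`);
* numerics (`blBound_mul_log_le`): with `c² = 4n²3^{3n} ≤ n⁴3^{3n}` (`n ≥ 2`),
  `(1-ε)⁻¹ (ln n - 1/(18c²)) ≤ ln n` for `ε = 3^{-3n}/(18n⁴ ln n)`.

Also: `IsConcise.card_le_asymptoticRank` (all three flattening bounds) and
`asymptoticSubrank_le_card₁₂₃` (`Q̃ ≤ ζ⁽ʲ⁾ ≤ |index set|`, from the proved duality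
`strassen_duality_asymptoticSubrank_holds`), used again for Thm. 16.

## References

* M. Bläser, V. Lysikov, MFCS 2020, LIPIcs 170, 17, Thm. 17 and its proof (p. 9), Prop. 15.
  [BlaserLysikov2020]
-/

noncomputable section

open scoped BigOperators

namespace Literature.Barriers.MatrixMultiplication

open Literature.Computability.AlgebraicComplexity

universe u

/-! ## Flattening bounds: `Q̃ ≤ ζ⁽ʲ⁾ ≤ |index set|`, and `ζ⁽ʲ⁾ = |index set| ≤ R̃` for concise tensors -/

section Flattening

variable {ι κ μ : Type} [Fintype ι] [Fintype κ] [Fintype μ]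

/-- `Q̃(t) ≤ |ι|`, `Q̃(t) ≤ |κ|`, `Q̃(t) ≤ |μ|` (the gauge points are spectral points, hence above
`Q̃` by the proved duality, and a span of `|X|` vectors has dimension `≤ |X|`). [cite: BlaserLysikov2020, §2.2] -/
theorem asymptoticSubrank_le_card₁₂₃ (t : ι → κ → μ → ℂ) :
    asymptoticSubrank ℂ t ≤ Fintype.card ι ∧ asymptoticSubrank ℂ t ≤ Fintype.card κ ∧
      asymptoticSubrank ℂ t ≤ Fintype.card μ := by
  have hd := (strassen_duality_asymptoticSubrank_holds (K := ℂ) t).1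
  have hg := gaugePoint_isUniversalSpectralPoint_holds ℂ
  refine ⟨(hd _ hg.1).trans ?_, (hd _ hg.2.1).trans ?_, (hd _ hg.2.2).trans ?_⟩
  · have h := finrank_range_le_card (R := ℂ) fun a : ι => fun p : κ × μ => t a p.1 p.2
    unfold Set.finrank at h
    change (Module.finrank ℂ _ : ℝ) ≤ _
    exact_mod_cast h
  · have h := finrank_range_le_card (R := ℂ) fun b : κ => fun p : ι × μ => t p.1 b p.2
    unfold Set.finrank at h
    change (Module.finrank ℂ _ : ℝ) ≤ _
    exact_mod_cast h
  · have h := finrank_range_le_card (R := ℂ) fun c : μ => fun p : ι × κ => t p.1 p.2 c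
    unfold Set.finrank at h
    change (Module.finrank ℂ _ : ℝ) ≤ _
    exact_mod_cast h

/-- For a concise tensor the three flattening ranks are the dimensions, so
`|ι|, |κ|, |μ| ≤ R̃(t)` (BL §2.2 and the "trivial lower bound `R̃(t) ≥ N(t)`", §4).
[cite: BlaserLysikov2020, §4] -/
theorem IsConcise.card_le_asymptoticRank {t : ι → κ → μ → ℂ} (h : IsConcise t) :
    (Fintype.card ι : ℝ) ≤ asymptoticRank t ∧ (Fintype.card κ : ℝ) ≤ asymptoticRank t ∧
      (Fintype.card μ : ℝ) ≤ asymptoticRank t := by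
  have hd := (strassen_duality_asymptoticRank_holds ℂ t).1
  have hg := gaugePoint_isUniversalSpectralPoint_holds ℂ
  refine ⟨le_of_eq_of_le ?_ (hd _ hg.1), le_of_eq_of_le ?_ (hd _ hg.2.1),
    le_of_eq_of_le ?_ (hd _ hg.2.2)⟩
  · change (Fintype.card ι : ℝ) = (Module.finrank ℂ _ : ℝ)
    exact_mod_cast (finrank_span_eq_card h.1).symm
  · change (Fintype.card κ : ℝ) = (Module.finrank ℂ _ : ℝ)
    exact_mod_cast (finrank_span_eq_card h.2.1).symm
  · change (Fintype.card μ : ℝ) = (Module.finrank ℂ _ : ℝ)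
    exact_mod_cast (finrank_span_eq_card h.2.2).symm

/-- `0 ≤ Q̃(t)`. [folklore] -/
theorem asymptoticSubrank_nonneg' (t : ι → κ → μ → ℂ) : 0 ≤ asymptoticSubrank ℂ t :=
  Real.iSup_nonneg fun N => by positivity

end Flattening

/-! ## Numerics of the constant -/

section Numerics

/-- The constant of Thm. 17 is the inverse of a number in `(0, 1]`: `0 < 1 - 3^{-3n}/(18 n⁴ ln n)`
for `n ≥ 2`. [folklore] -/
theorem blBound_denom_pos {n : ℕ} (hn : 2 ≤ n) :
    0 < 1 - (3 : ℝ) ^ (-(3 * (n : ℝ))) / (18 * (n : ℝ) ^ 4 * Real.log n) := by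
  have h := one_lt_blaserLysikovBound hn
  by_contra hle
  rw [not_lt] at hle
  have := inv_nonpos.2 hle
  linarith

/-- The arithmetic behind Thm. 17: with `c = 2n·√3^{3n}` (so `c² = 4n²3^{3n} ≤ n⁴3^{3n}` as
`n ≥ 2`), `(1 - 3^{-3n}/(18n⁴ ln n))⁻¹ · (ln n - 1/(2(3c)²)) ≤ ln n`. [cite: BlaserLysikov2020, Thm. 17 (proof)] -/
theorem blBound_mul_log_sub_le {n : ℕ} (hn : 2 ≤ n) :
    (1 - (3 : ℝ) ^ (-(3 * (n : ℝ))) / (18 * (n : ℝ) ^ 4 * Real.log n))⁻¹ *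
        (Real.log n - 1 / (2 * ((2 * n * Real.sqrt 3 ^ (3 * n)) + (2 * n * Real.sqrt 3 ^ (3 * n)) +
          (2 * n * Real.sqrt 3 ^ (3 * n))) ^ 2)) ≤ Real.log n := by
  have hn' : (2 : ℝ) ≤ n := by exact_mod_cast hn
  have hnpos : (0 : ℝ) < n := by linarith
  have hL : 0 < Real.log n := Real.log_pos (by linarith)
  have hden := blBound_denom_pos hn
  set ε : ℝ := (3 : ℝ) ^ (-(3 * (n : ℝ))) / (18 * (n : ℝ) ^ 4 * Real.log n) with hε
  set c : ℝ := 2 * n * Real.sqrt 3 ^ (3 * n) with hc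
  -- `3^{-3n} = (3^{3n})⁻¹` and `c² = 4 n² 3^{3n}`
  have hpow : (3 : ℝ) ^ (-(3 * (n : ℝ))) = ((3 : ℝ) ^ (3 * n))⁻¹ := by
    rw [Real.rpow_neg (by norm_num), show (3 * (n : ℝ)) = ((3 * n : ℕ) : ℝ) by push_cast; ring,
      Real.rpow_natCast]
  have hsq : c ^ 2 = 4 * (n : ℝ) ^ 2 * (3 : ℝ) ^ (3 * n) := by
    have h3 : (Real.sqrt 3 ^ (3 * n)) ^ 2 = (3 : ℝ) ^ (3 * n) := by
      rw [← pow_mul, mul_comm, pow_mul, Real.sq_sqrt (by norm_num)]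
    rw [hc, mul_pow, mul_pow, h3]
    ring
  have h3pos : (0 : ℝ) < (3 : ℝ) ^ (3 * n) := by positivity
  -- `L ε ≤ δ`
  have hkey : Real.log n * ε ≤ 1 / (2 * (c + c + c) ^ 2) := by
    have h1 : Real.log n * ε = 1 / (18 * (n : ℝ) ^ 4 * (3 : ℝ) ^ (3 * n)) := by
      rw [hε, hpow]
      field_simp
    have h2 : 1 / (2 * (c + c + c) ^ 2) = 1 / (72 * (n : ℝ) ^ 2 * (3 : ℝ) ^ (3 * n)) := by
      rw [show (c + c + c) ^ 2 = 9 * c ^ 2 by ring, hsq]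
      ring
    rw [h1, h2]
    apply one_div_le_one_div_of_le (by positivity)
    have hn2 : (4 : ℝ) ≤ (n : ℝ) ^ 2 := by nlinarith
    have : 72 * (n : ℝ) ^ 2 ≤ 18 * (n : ℝ) ^ 4 := by nlinarith
    exact mul_le_mul_of_nonneg_right this h3pos.le
  -- conclude
  rw [inv_mul_le_iff₀ hden]
  nlinarith [hkey, hL]

end Numerics

/-! ## The discharge -/

section Discharge

/-- **Bläser–Lysikov 2020, Theorem 17** (discharge of `BlaserLysikov2020_thm17`): the
irreversibility of an unstable concise tensor in `ℂ^{n×n×n}` (`n ≥ 2`) is at least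
`(1 − 3^{−3n}/(18 n⁴ ln n))^{−1}`, in the denominator-cleared form
`B · log Q̃(t) ≤ log R̃(t)`. Proof: torus form of instability, explicit weight bound, Tao's slice
rank method with Hoeffding, and `R̃ ≥ N` for concise tensors. [cite: BlaserLysikov2020, Thm. 17] -/
theorem BlaserLysikov2020_thm17_holds : BlaserLysikov2020_thm17 := by
  intro ι κ μ _ _ _ _ _ _ n hn hι hκ hμ t hu hc
  classical
  have hn0 : 0 < n := by omega
  have hn' : (2 : ℝ) ≤ n := by exact_mod_cast hn
  have hnpos : (0 : ℝ) < n := by linarith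
  have hL : 0 < Real.log n := Real.log_pos (by linarith)
  -- (A) separating weight on a unitary change of bases
  obtain ⟨s, hst, -, x, y, z, hx, hy, hz, hsep⟩ := hu.exists_sepWeight
  -- (C) bounded separating weight
  set S : Finset (ι × κ × μ) := Finset.univ.filter fun p => s p.1 p.2.1 p.2.2 ≠ 0 with hS
  obtain ⟨x', y', z', hx', hy', hz', hsep', hbx, hby, hbz⟩ :=
    exists_bounded_sepWeight hn0 hι hκ hμ S x y z hx hy hz
      (fun p hp => hsep p.1 p.2.1 p.2.2 (by simpa [hS] using hp))
  -- (B) the asymptotic subrank bound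
  set c : ℝ := 2 * n * Real.sqrt 3 ^ (3 * n) with hcdef
  have hcpos : 0 < c := by positivity
  have hQ := asymptoticSubrank_le_of_sepWeight t s hst x' y' z' hx' hy' hz' hcpos hcpos hcpos
    hbx hby hbz (fun a b c' h => hsep' (a, b, c') (by simpa [hS] using h)) hι.le hκ.le hμ.le
  -- `R̃ ≥ n`
  have hR : (n : ℝ) ≤ asymptoticRank t := by
    have := hc.card_le_asymptoticRank.1
    rwa [hι] at this
  have hlogR : Real.log n ≤ Real.log (asymptoticRank t) := Real.log_le_log hnpos hR
  have hBpos : 0 < (1 - (3 : ℝ) ^ (-(3 * (n : ℝ))) / (18 * (n : ℝ) ^ 4 * Real.log n))⁻¹ :=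
    inv_pos.2 (blBound_denom_pos hn)
  by_cases hq : asymptoticSubrank ℂ t ≤ 1
  · -- `log Q̃ ≤ 0 ≤ log n ≤ log R̃`
    have hlogQ : Real.log (asymptoticSubrank ℂ t) ≤ 0 :=
      Real.log_nonpos (asymptoticSubrank_nonneg' t) hq
    have : (1 - (3 : ℝ) ^ (-(3 * (n : ℝ))) / (18 * (n : ℝ) ^ 4 * Real.log n))⁻¹ *
        Real.log (asymptoticSubrank ℂ t) ≤ 0 :=
      mul_nonpos_of_nonneg_of_nonpos hBpos.le hlogQ
    linarith
  · rw [not_le] at hq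
    have hQpos : 0 < asymptoticSubrank ℂ t := by linarith
    have hlogQ : Real.log (asymptoticSubrank ℂ t) ≤ Real.log n - 1 / (2 * (c + c + c) ^ 2) := by
      have h1 := Real.log_le_log hQpos hQ
      rw [Real.log_mul hnpos.ne' (Real.exp_pos _).ne', Real.log_exp] at h1
      linarith
    calc (1 - (3 : ℝ) ^ (-(3 * (n : ℝ))) / (18 * (n : ℝ) ^ 4 * Real.log n))⁻¹ *
          Real.log (asymptoticSubrank ℂ t)
        ≤ (1 - (3 : ℝ) ^ (-(3 * (n : ℝ))) / (18 * (n : ℝ) ^ 4 * Real.log n))⁻¹ *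
          (Real.log n - 1 / (2 * (c + c + c) ^ 2)) := mul_le_mul_of_nonneg_left hlogQ hBpos.le
      _ ≤ Real.log n := blBound_mul_log_sub_le hn
      _ ≤ Real.log (asymptoticRank t) := hlogR

end Discharge

end Literature.Barriers.MatrixMultiplication

end
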